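import Literature.Geometry.Lorentzian.KerrCylinderParameterCloseness
import Literature.Geometry.Lorentzian.MultiCentreKerrSchild
import Literature.Geometry.Lorentzian.BilinPullbackEstimates
import HarnessLib

/-!
# Route ClusterCompleteness · crux `OmegaLimitMultiKerr` — select-and-rebase, motion half:
# `Cᵏ` closeness to boosted Kerr with converging motions is `Cᵏ` closeness to the limit motion

Structure lemmas for the crux stmt-FinalStateConjecture-14664
(`ClusterCompleteness.OmegaLimitMultiKerr`), line `Sketch`, lead gen 4; the twin of
`ClusterCompletenessOmegaLimitMultiKerrLabelRebase` (the label half). The recur-disjunct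
`Recurs k 𝒟` of the crux (`ClusterCompletenessOmegaLimitMultiKerrDefs`) asks `Cᵏ` `ε`-recurrence
of each hole chart to ONE FIXED boosted Kerr–Schild field `boostedKerrBilin Λ c M a` — label
`(M, a)` AND motion `(Λ, c)` fixed before `ε` — while every ω-limit / selection argument produces
closeness to fields `boostedKerrBilin Λₙ cₙ Mₙ aₙ` whose labels and motions WANDER along the
sequence of times. This file rebases such closeness to the limit configuration when labels and
motions converge; with `LabelRebase` it completes the re-basing step of the idea card
select-and-rebase for the crux's fixed-configuration recurrence clause.

Design point. By definition (`KerrConvergence`: `boostedKerrBilin`,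
`poincareInv Λ c x = Λ⁻¹(x − c)`)
`boostedKerrBilin Λ c M a x = (precomp ℝ L) ∘L (g_{M,a}(L(x − c)) ∘L L)` with `L = Λ⁻¹` read as a
continuous linear map: only the INVERSE boost enters, as a point of the finite-dimensional normed
space `E4 →L[ℝ] E4`. So a configuration is a point `p = ((M, a), (L, c))` of
`(ℝ × ℝ) × ((E4 →L[ℝ] E4) × E4)`, the family is
`g_p(x) = (precomp ℝ L) ∘L (g_{M,a}(L(x − c)) ∘L L)`, and "the motions converge" means
`Λₙ⁻¹ → Λ₀⁻¹` in operator norm together with `cₙ → c₀` (no continuity of inversion on the Lorentz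
group is involved).

* `contDiffAt_precomp_kerrBilin_comp` — composition form of the joint smoothness of
  `(M, a, L, c, x) ↦ g_{((M,a),(L,c))}(x)` wherever `r_a(L(x − c)) > 0` (`Kerr.contDiffAt_bilin₃`;
  evaluation and composition of continuous linear maps are bounded bilinear, and
  `L ↦ precomp ℝ L = (compL ℝ E4 E4 ℝ).flip L` is continuous linear);
* `contDiffAt_precomp_kerrBilin_param` — the same on the configuration space, jointly in `(p, x)`;
* `boostedKerrBilin_eq_precomp_kerrBilin` — `boostedKerrBilin Λ c M a` IS the member
  `p = ((M, a), (Λ⁻¹, c))` of the family (`rfl`);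
* `isOpen_setOf_radius_param_pos` — positivity of the rest-frame radius is open in `(p, x)`;
* `exists_norm_iteratedFDeriv_precomp_kerrBilin_sub_le` — LIPSCHITZ IN LABELS AND MOTION: on
  `Par × K` (`Par` convex compact, `K ⊆ E4` compact, radius positive on `Par × K`) all
  `x`-derivatives of order `≤ k` satisfy `‖Dⁱ g_{p'}(x) − Dⁱ g_p(x)‖ ≤ C ‖p' − p‖` (the tree's
  parametric mean value inequality
  `Literature.Analysis.Calculus.exists_norm_iteratedFDeriv_sub_le_parametric`);
* `exists_eventually_supCkENorm_sub_precomp_kerrBilin_le`,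
  `tendsto_supCkENorm_sub_precomp_kerrBilin_of_tendsto` — for configurations `pₙ → p₀` and fields
  `Gₙ` of class `Cᵏ` near `K`, eventually
  `‖Gₙ − g_{p₀}‖_{Cᵏ(K)} ≤ ‖Gₙ − g_{pₙ}‖_{Cᵏ(K)} + C ‖pₙ − p₀‖`, hence
  `‖Gₙ − g_{pₙ}‖_{Cᵏ(K)} → 0` implies `‖Gₙ − g_{p₀}‖_{Cᵏ(K)} → 0` (here the limit frame `L₀` is an
  arbitrary operator: the Lorentz condition is not needed for the estimate);
* `tendsto_supCkENorm_sub_boostedKerrBilin_of_tendsto_labels_motions` (the registered stub,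
  closed form) — labels `(Mₙ, aₙ) → (M₀, a₀)`, inverse boosts `Λₙ⁻¹ → Λ₀⁻¹` (operator norm),
  centres `cₙ → c₀` and `‖Gₙ − boostedKerrBilin Λₙ cₙ Mₙ aₙ‖_{Cᵏ(K)} → 0` imply
  `‖Gₙ − boostedKerrBilin Λ₀ c₀ M₀ a₀‖_{Cᵏ(K)} → 0`;
* `tendsto_supCkENorm_sub_boostedKerrBilin_of_tendsto_motions` — the motion-only form (labels
  fixed); `frequently_supCkENorm_sub_boostedKerrBilin_le_of_tendsto_labels_motions` — the
  `∃ᶠ`-form of the crux's recurrence clause.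

Everything is proved; Mathlib + `Literature` only. (Elaboration note, as in `LabelRebase`:
applications whose expected type contains `Kerr.radius`, `Kerr.bilin` or `boostedKerrBilin` of
projections of a metavariable are built with `have h := …` first and matched afterwards.)
-/

-- every `Summit.FinalStateConjecture.FinalStateConjecture.…` name repeats the summit = sub-problem segment (D-0017 layout)
set_option linter.dupNamespace false

noncomputable section

open scoped Manifold ContDiff Topology ENNReal
open Set Filter TopologicalSpace

namespace Summit.FinalStateConjecture.FinalStateConjecture.Theorems.ClusterCompleteness

open Literature.Geometry.Lorentzian

/-! ### Joint smoothness of the boosted Kerr–Schild family in labels, motion and point -/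

/-- **Composition form of the joint smoothness of the boosted Kerr–Schild family.** If the labels
`y ↦ M(y)`, `y ↦ a(y)`, the inverse boosts `y ↦ L(y)` (as operators), the centres `y ↦ c(y)` and
the points `y ↦ z(y)` are `Cⁿ` at `y₀` and `r_{a(y₀)}(L(y₀)(z(y₀) − c(y₀))) > 0`, then
`y ↦ (precomp ℝ L(y)) ∘L (g_{M(y),a(y)}(L(y)(z(y) − c(y))) ∘L L(y))` is `Cⁿ` at `y₀`:
`Kerr.contDiffAt_bilin₃` along `y ↦ (M, a, L(z − c))` (evaluation of operators is bounded
bilinear, `ContDiffAt.clm_apply`), composition of operators is bounded bilinear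
(`ContDiffAt.clm_comp`), and `L ↦ precomp ℝ L = (compL ℝ E4 E4 ℝ).flip L` is continuous linear.
Kerr–Schild 1965, §3 (Lorentz covariance of the Kerr–Schild ansatz). [cite: KerrSchild1965, §3] -/
theorem contDiffAt_precomp_kerrBilin_comp {X : Type*} [NormedAddCommGroup X] [NormedSpace ℝ X]
    {fM fa : X → ℝ} {fL : X → E4 →L[ℝ] E4} {fc fz : X → E4} {y : X} {n : WithTop ℕ∞}
    (hM : ContDiffAt ℝ n fM y) (ha : ContDiffAt ℝ n fa y) (hL : ContDiffAt ℝ n fL y)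
    (hc : ContDiffAt ℝ n fc y) (hz : ContDiffAt ℝ n fz y)
    (hr : 0 < Kerr.radius (fa y) (fL y (fz y - fc y))) :
    ContDiffAt ℝ n (fun y ↦ (ContinuousLinearMap.precomp ℝ (fL y)).comp
      ((Kerr.bilin (fM y) (fa y) (fL y (fz y - fc y))).comp (fL y))) y := by
  have hw : ContDiffAt ℝ n (fun y ↦ fL y (fz y - fc y)) y := hL.clm_apply (hz.sub hc)
  have hf : ContDiffAt ℝ n (fun y ↦ (fM y, fa y, fL y (fz y - fc y))) y :=
    hM.prodMk (ha.prodMk hw)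
  have hg := Kerr.contDiffAt_bilin₃ (n := n) (q := (fM y, fa y, fL y (fz y - fc y))) hr
  have h := hg.comp y hf
  have hK : ContDiffAt ℝ n (fun y ↦ Kerr.bilin (fM y) (fa y) (fL y (fz y - fc y))) y := h
  -- `precomp ℝ L = (compL ℝ E4 E4 ℝ).flip L` definitionally, a continuous linear function of `L`
  have hpre : ContDiffAt ℝ n (fun y ↦ ContinuousLinearMap.precomp ℝ (fL y) :
      X → (E4 →L[ℝ] ℝ) →L[ℝ] E4 →L[ℝ] ℝ) y := by
    have h2 := ContDiffAt.continuousLinearMap_comp (G := (E4 →L[ℝ] ℝ) →L[ℝ] (E4 →L[ℝ] ℝ))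
      ((ContinuousLinearMap.compL ℝ E4 E4 ℝ).flip) hL
    exact h2
  exact hpre.clm_comp (hK.clm_comp hL)

/-- **Joint smoothness on the configuration space**: `(p, x) ↦ g_p(x) =
(precomp ℝ L) ∘L (g_{M,a}(L(x − c)) ∘L L)`, `p = ((M, a), (L, c))`, is `Cⁿ` at every `(p, x)`
with `r_a(L(x − c)) > 0` (`contDiffAt_precomp_kerrBilin_comp` along the coordinate projections).
Kerr–Schild 1965, §3. [cite: KerrSchild1965, §3] -/
theorem contDiffAt_precomp_kerrBilin_param {q : ((ℝ × ℝ) × ((E4 →L[ℝ] E4) × E4)) × E4}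
    (hq : 0 < Kerr.radius q.1.1.2 (q.1.2.1 (q.2 - q.1.2.2))) {n : WithTop ℕ∞} :
    ContDiffAt ℝ n (fun q : ((ℝ × ℝ) × ((E4 →L[ℝ] E4) × E4)) × E4 ↦
      (ContinuousLinearMap.precomp ℝ q.1.2.1).comp
        ((Kerr.bilin q.1.1.1 q.1.1.2 (q.1.2.1 (q.2 - q.1.2.2))).comp q.1.2.1)) q :=
  contDiffAt_precomp_kerrBilin_comp contDiffAt_fst.fst.fst contDiffAt_fst.fst.snd
    contDiffAt_fst.snd.fst contDiffAt_fst.snd.snd contDiffAt_snd hq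

/-- **`boostedKerrBilin Λ c M a` is the member `p = ((M, a), (Λ⁻¹, c))` of the family**:
`boostedKerrBilin Λ c M a x = (precomp ℝ L) ∘L (g_{M,a}(L(x − c)) ∘L L)` with
`L = ((Λ : E4 ≃L[ℝ] E4).symm : E4 →L[ℝ] E4)` — the definitional unfolding of `boostedKerrBilin`
and `poincareInv Λ c x = Λ⁻¹(x − c)`, recorded for rewriting. Kerr–Schild 1965, §3 (Lorentz
covariance of the ansatz). [cite: KerrSchild1965, §3] -/
theorem boostedKerrBilin_eq_precomp_kerrBilin (Λ : lorentzGroup) (c : E4) (M a : ℝ) (x : E4) :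
    boostedKerrBilin Λ c M a x =
      (ContinuousLinearMap.precomp ℝ ((Λ : E4 ≃L[ℝ] E4).symm : E4 →L[ℝ] E4)).comp
        ((Kerr.bilin M a (((Λ : E4 ≃L[ℝ] E4).symm : E4 →L[ℝ] E4) (x - c))).comp
          ((Λ : E4 ≃L[ℝ] E4).symm : E4 →L[ℝ] E4)) :=
  rfl

/-- The Kerr–Schild radius `r_a(y)` is jointly continuous in `(a, y)` on all of `ℝ × E4`
(polynomials and square roots; Visser arXiv:0706.0622, (35)). [cite: arXiv07060622, (35)] -/
private theorem continuous_kerrRadius_uncurry :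
    Continuous fun q : ℝ × E4 ↦ Kerr.radius q.1 q.2 := by
  unfold Kerr.radius E4.spatialNorm
  fun_prop

/-- **Positivity of the rest-frame radius is an open condition in `(p, x)`**: the set
`{(p, x) | 0 < r_a(L(x − c))}`, `p = ((M, a), (L, c))`, is open in the configuration space times
`E4` (joint continuity of the Kerr–Schild radius and of evaluation `(L, v) ↦ L v`). [folklore] -/
theorem isOpen_setOf_radius_param_pos :
    IsOpen {q : ((ℝ × ℝ) × ((E4 →L[ℝ] E4) × E4)) × E4 |
      0 < Kerr.radius q.1.1.2 (q.1.2.1 (q.2 - q.1.2.2))} := by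
  have hg : Continuous fun q : ((ℝ × ℝ) × ((E4 →L[ℝ] E4) × E4)) × E4 ↦
      (q.1.1.2, q.1.2.1 (q.2 - q.1.2.2)) := by
    fun_prop
  have h := continuous_kerrRadius_uncurry.comp hg
  exact isOpen_lt continuous_const h

/-! ### Lipschitz dependence on labels and motion -/

/-- **The boosted Kerr–Schild family is `Cᵏ`-Lipschitz in labels and motion on compacts of
`{r > 0}`.** For a convex compact set `Par` of configurations `p = ((M, a), (L, c))` and a compact
`K ⊆ E4` with `r_a(L(x − c)) > 0` for all `p ∈ Par`, `x ∈ K`, there is `C ≥ 0` with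
`‖Dⁱ g_{p'}(x) − Dⁱ g_p(x)‖ ≤ C ‖p' − p‖` for all `i ≤ k`, `p, p' ∈ Par`, `x ∈ K`, where
`g_p(x) = (precomp ℝ L) ∘L (g_{M,a}(L(x − c)) ∘L L)` (joint smoothness and the mean value
inequality in the parameters,
`Literature.Analysis.Calculus.exists_norm_iteratedFDeriv_sub_le_parametric`; Dieudonné 1960,
(8.5.4), (8.12.6)). [folklore] -/
theorem exists_norm_iteratedFDeriv_precomp_kerrBilin_sub_le
    {Par : Set ((ℝ × ℝ) × ((E4 →L[ℝ] E4) × E4))} (hPar : IsCompact Par) (hParc : Convex ℝ Par)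
    {K : Set E4} (hK : IsCompact K)
    (hpos : ∀ p ∈ Par, ∀ x ∈ K, 0 < Kerr.radius p.1.2 (p.2.1 (x - p.2.2))) (k : ℕ) :
    ∃ C : ℝ, 0 ≤ C ∧ ∀ i ≤ k, ∀ p ∈ Par, ∀ p' ∈ Par, ∀ x ∈ K,
      ‖iteratedFDeriv ℝ i (fun z ↦ (ContinuousLinearMap.precomp ℝ p'.2.1).comp
            ((Kerr.bilin p'.1.1 p'.1.2 (p'.2.1 (z - p'.2.2))).comp p'.2.1)) x -
          iteratedFDeriv ℝ i (fun z ↦ (ContinuousLinearMap.precomp ℝ p.2.1).comp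
            ((Kerr.bilin p.1.1 p.1.2 (p.2.1 (z - p.2.2))).comp p.2.1)) x‖ ≤ C * ‖p' - p‖ := by
  have hF : ∀ q ∈ {q : ((ℝ × ℝ) × ((E4 →L[ℝ] E4) × E4)) × E4 |
        0 < Kerr.radius q.1.1.2 (q.1.2.1 (q.2 - q.1.2.2))},
      ContDiffAt ℝ ∞ (fun q : ((ℝ × ℝ) × ((E4 →L[ℝ] E4) × E4)) × E4 ↦
        (ContinuousLinearMap.precomp ℝ q.1.2.1).comp
          ((Kerr.bilin q.1.1.1 q.1.1.2 (q.1.2.1 (q.2 - q.1.2.2))).comp q.1.2.1)) q :=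
    fun q hq ↦ contDiffAt_precomp_kerrBilin_param hq
  exact Literature.Analysis.Calculus.exists_norm_iteratedFDeriv_sub_le_parametric
    isOpen_setOf_radius_param_pos hF hPar hParc hK (fun q hq ↦ hpos q.1 hq.1 q.2 hq.2) k

/-! ### Rebasing `Cᵏ` closeness to the limit configuration -/

/-- **Eventual comparison.** Let `K ⊆ E4` be compact with `r_{a₀}(L₀(x − c₀)) > 0` on `K` for the
limit configuration `p₀ = ((M₀, a₀), (L₀, c₀))`, let `pₙ → p₀`, and let `Gₙ` be fields of bilinear
forms of class `Cᵏ` on an open `O ⊇ K`. Then there is `C ≥ 0` such that for all large `n`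
`‖Gₙ − g_{p₀}‖_{Cᵏ(K)} ≤ ‖Gₙ − g_{pₙ}‖_{Cᵏ(K)} + C ‖pₙ − p₀‖`: positivity of the radius is open in
`(p, x)`, so by the tube lemma a closed ball of configurations around `p₀` times `K` stays in
`{r > 0}`; there the family is `Cᵏ`-Lipschitz in the configuration
(`exists_norm_iteratedFDeriv_precomp_kerrBilin_sub_le`), and `pₙ` is eventually in the ball.
[folklore] -/
theorem exists_eventually_supCkENorm_sub_precomp_kerrBilin_le {K : Set E4} (hK : IsCompact K)
    {π₀ : (ℝ × ℝ) × ((E4 →L[ℝ] E4) × E4)}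
    (hπ₀ : ∀ x ∈ K, 0 < Kerr.radius π₀.1.2 (π₀.2.1 (x - π₀.2.2))) {k : ℕ} {O : Set E4}
    (hO : IsOpen O) (hKO : K ⊆ O) {G : ℕ → E4 → E4 →L[ℝ] E4 →L[ℝ] ℝ}
    (hG : ∀ n, ContDiffOn ℝ k (G n) O) {π : ℕ → (ℝ × ℝ) × ((E4 →L[ℝ] E4) × E4)}
    (hπ : Tendsto π atTop (𝓝 π₀)) :
    ∃ C : ℝ, 0 ≤ C ∧ ∀ᶠ n in atTop,
      supCkENorm K k (fun x ↦ G n x - (ContinuousLinearMap.precomp ℝ π₀.2.1).comp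
          ((Kerr.bilin π₀.1.1 π₀.1.2 (π₀.2.1 (x - π₀.2.2))).comp π₀.2.1)) ≤
        supCkENorm K k (fun x ↦ G n x - (ContinuousLinearMap.precomp ℝ (π n).2.1).comp
          ((Kerr.bilin (π n).1.1 (π n).1.2 ((π n).2.1 (x - (π n).2.2))).comp (π n).2.1)) +
          ENNReal.ofReal (C * ‖π n - π₀‖) := by
  -- a closed ball of configurations around `π₀` over which the radius stays positive on `K`
  obtain ⟨u, v, hu, -, hπ₀u, hKv, huv⟩ := generalized_tube_lemma isCompact_singleton hK
    isOpen_setOf_radius_param_pos (fun q hq ↦ by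
      obtain ⟨h1, h2⟩ := hq
      rw [mem_singleton_iff] at h1
      show 0 < Kerr.radius q.1.1.2 (q.1.2.1 (q.2 - q.1.2.2))
      rw [h1]
      exact hπ₀ q.2 h2)
  obtain ⟨δ, hδ, hball⟩ := Metric.isOpen_iff.1 hu π₀ (hπ₀u (mem_singleton π₀))
  have hParu : Metric.closedBall π₀ (δ / 2) ⊆ u :=
    (Metric.closedBall_subset_ball (half_lt_self hδ)).trans hball
  have hpos : ∀ p ∈ Metric.closedBall π₀ (δ / 2), ∀ x ∈ K,
      0 < Kerr.radius p.1.2 (p.2.1 (x - p.2.2)) := fun p hp x hx ↦ by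
    have h := huv (mk_mem_prod (hParu hp) (hKv hx))
    exact h
  obtain ⟨C, hC0, hC⟩ := exists_norm_iteratedFDeriv_precomp_kerrBilin_sub_le
    (isCompact_closedBall π₀ (δ / 2)) (convex_closedBall π₀ (δ / 2)) hK hpos k
  have hπ₀B : π₀ ∈ Metric.closedBall π₀ (δ / 2) := Metric.mem_closedBall_self (half_pos hδ).le
  refine ⟨C, hC0, ?_⟩
  filter_upwards [hπ (Metric.closedBall_mem_nhds π₀ (half_pos hδ))] with n hn
  refine supCkENorm_le_of_forall_le fun m hm x hx ↦ ?_
  -- `Dᵐ(Gₙ − g_{π₀}) = Dᵐ(Gₙ − g_{πₙ}) + (Dᵐ g_{πₙ} − Dᵐ g_{π₀})` at `x` (all three `Cᵐ` at `x`)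
  have hm' : (m : WithTop ℕ∞) ≤ k := by exact_mod_cast hm
  have hGx : ContDiffAt ℝ m (G n) x := ((hG n).contDiffAt (hO.mem_nhds (hKO hx))).of_le hm'
  have hBn : ContDiffAt ℝ m (fun z ↦ (ContinuousLinearMap.precomp ℝ (π n).2.1).comp
      ((Kerr.bilin (π n).1.1 (π n).1.2 ((π n).2.1 (z - (π n).2.2))).comp (π n).2.1)) x :=
    contDiffAt_precomp_kerrBilin_comp contDiffAt_const contDiffAt_const contDiffAt_const
      contDiffAt_const contDiffAt_id (hpos (π n) hn x hx)
  have hB₀ : ContDiffAt ℝ m (fun z ↦ (ContinuousLinearMap.precomp ℝ π₀.2.1).comp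
      ((Kerr.bilin π₀.1.1 π₀.1.2 (π₀.2.1 (z - π₀.2.2))).comp π₀.2.1)) x :=
    contDiffAt_precomp_kerrBilin_comp contDiffAt_const contDiffAt_const contDiffAt_const
      contDiffAt_const contDiffAt_id (hπ₀ x hx)
  have e₀ := fun_iteratedFDeriv_sub_apply hGx hB₀
  have eₙ := fun_iteratedFDeriv_sub_apply hGx hBn
  rw [e₀]
  calc ‖iteratedFDeriv ℝ m (G n) x - iteratedFDeriv ℝ m (fun z ↦
          (ContinuousLinearMap.precomp ℝ π₀.2.1).comp
            ((Kerr.bilin π₀.1.1 π₀.1.2 (π₀.2.1 (z - π₀.2.2))).comp π₀.2.1)) x‖ₑ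
      = ‖(iteratedFDeriv ℝ m (G n) x - iteratedFDeriv ℝ m (fun z ↦
          (ContinuousLinearMap.precomp ℝ (π n).2.1).comp
            ((Kerr.bilin (π n).1.1 (π n).1.2 ((π n).2.1 (z - (π n).2.2))).comp (π n).2.1)) x) +
          (iteratedFDeriv ℝ m (fun z ↦ (ContinuousLinearMap.precomp ℝ (π n).2.1).comp
            ((Kerr.bilin (π n).1.1 (π n).1.2 ((π n).2.1 (z - (π n).2.2))).comp (π n).2.1)) x -
          iteratedFDeriv ℝ m (fun z ↦ (ContinuousLinearMap.precomp ℝ π₀.2.1).comp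
            ((Kerr.bilin π₀.1.1 π₀.1.2 (π₀.2.1 (z - π₀.2.2))).comp π₀.2.1)) x)‖ₑ := by
        rw [sub_add_sub_cancel]
    _ ≤ _ := enorm_add_le _ _
    _ ≤ _ := by
        refine add_le_add ?_ ?_
        · rw [← eₙ]
          exact enorm_iteratedFDeriv_le_supCkENorm hm hx _
        · rw [← ofReal_norm]
          exact ENNReal.ofReal_le_ofReal (hC m hm π₀ hπ₀B (π n) hn x hx)

/-- **Rebasing to the limit configuration (abstract frame).** For a compact `K ⊆ E4` on which the
rest-frame radius of the limit configuration `p₀ = ((M₀, a₀), (L₀, c₀))` is positive, fields `Gₙ`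
of class `Cᵏ` on an open `O ⊇ K`, and configurations `pₙ → p₀` (labels, inverse boosts in
operator norm, centres): if `‖Gₙ − g_{pₙ}‖_{Cᵏ(K)} → 0` then `‖Gₙ − g_{p₀}‖_{Cᵏ(K)} → 0`
(`exists_eventually_supCkENorm_sub_precomp_kerrBilin_le` and `C ‖pₙ − p₀‖ → 0`). The limit frame
`L₀` is an arbitrary operator here. [folklore] -/
theorem tendsto_supCkENorm_sub_precomp_kerrBilin_of_tendsto {K : Set E4} (hK : IsCompact K)
    {π₀ : (ℝ × ℝ) × ((E4 →L[ℝ] E4) × E4)}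
    (hπ₀ : ∀ x ∈ K, 0 < Kerr.radius π₀.1.2 (π₀.2.1 (x - π₀.2.2))) {k : ℕ} {O : Set E4}
    (hO : IsOpen O) (hKO : K ⊆ O) {G : ℕ → E4 → E4 →L[ℝ] E4 →L[ℝ] ℝ}
    (hG : ∀ n, ContDiffOn ℝ k (G n) O) {π : ℕ → (ℝ × ℝ) × ((E4 →L[ℝ] E4) × E4)}
    (hπ : Tendsto π atTop (𝓝 π₀))
    (hT : Tendsto (fun n ↦ supCkENorm K k (fun x ↦ G n x -
      (ContinuousLinearMap.precomp ℝ (π n).2.1).comp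
        ((Kerr.bilin (π n).1.1 (π n).1.2 ((π n).2.1 (x - (π n).2.2))).comp (π n).2.1)))
      atTop (𝓝 0)) :
    Tendsto (fun n ↦ supCkENorm K k (fun x ↦ G n x -
      (ContinuousLinearMap.precomp ℝ π₀.2.1).comp
        ((Kerr.bilin π₀.1.1 π₀.1.2 (π₀.2.1 (x - π₀.2.2))).comp π₀.2.1))) atTop (𝓝 0) := by
  obtain ⟨C, -, hbound⟩ :=
    exists_eventually_supCkENorm_sub_precomp_kerrBilin_le hK hπ₀ hO hKO hG hπ
  have hπn : Tendsto (fun n ↦ ENNReal.ofReal (C * ‖π n - π₀‖)) atTop (𝓝 0) := by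
    have h := (tendsto_iff_norm_sub_tendsto_zero.1 hπ).const_mul C
    rw [mul_zero] at h
    simpa only [ENNReal.ofReal_zero] using ENNReal.tendsto_ofReal h
  have hsum := hT.add hπn
  rw [add_zero] at hsum
  exact tendsto_of_tendsto_of_tendsto_of_le_of_le' tendsto_const_nhds hsum
    (Eventually.of_forall fun _ ↦ zero_le) hbound

/-- **Select-and-rebase, MOTION half (with labels): `Cᵏ` closeness on a compact set to boosted
Kerr with converging motions (inverse boosts converging in operator norm, centres converging) and
converging labels is `Cᵏ` closeness to the limit configuration.** For a compact `K ⊆ E4` on which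
the rest-frame radius `r_{a₀}(Λ₀⁻¹(x − c₀))` of the limit configuration is positive, fields `Gₙ`
of class `Cᵏ` on an open `O ⊇ K`, motions `(Λₙ, cₙ)` with `Λₙ⁻¹ → Λ₀⁻¹` in `E4 →L[ℝ] E4` and
`cₙ → c₀`, and labels `(Mₙ, aₙ) → (M₀, a₀)`: if
`‖Gₙ − boostedKerrBilin Λₙ cₙ Mₙ aₙ‖_{Cᵏ(K)} → 0` then
`‖Gₙ − boostedKerrBilin Λ₀ c₀ M₀ a₀‖_{Cᵏ(K)} → 0`
(`boostedKerrBilin Λ c M a` is the member `((M, a), (Λ⁻¹, c))` of the configuration family,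
`boostedKerrBilin_eq_precomp_kerrBilin`, and `tendsto_supCkENorm_sub_precomp_kerrBilin_of_tendsto`).
With `LabelRebase` this completes the re-basing step of idea card select-and-rebase for the
crux's fixed-configuration recurrence clause. Stated in closed form (registered structure stub of
the crux stmt-FinalStateConjecture-14664); Lorentz covariance of the Kerr–Schild family:
Kerr–Schild 1965, §3. [folklore] -/
theorem tendsto_supCkENorm_sub_boostedKerrBilin_of_tendsto_labels_motions :
    ∀ {K : Set E4}, IsCompact K → ∀ {Λ₀ : lorentzGroup} {c₀ : E4} {p₀ : ℝ × ℝ},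
      (∀ x ∈ K, 0 < Kerr.radius p₀.2 (poincareInv Λ₀ c₀ x)) → ∀ {k : ℕ} {O : Set E4}, IsOpen O →
      K ⊆ O → ∀ {G : ℕ → E4 → E4 →L[ℝ] E4 →L[ℝ] ℝ}, (∀ n, ContDiffOn ℝ k (G n) O) →
      ∀ {Λs : ℕ → lorentzGroup} {cs : ℕ → E4} {p : ℕ → ℝ × ℝ},
      Tendsto (fun n ↦ ((Λs n : E4 ≃L[ℝ] E4).symm : E4 →L[ℝ] E4)) atTop
        (𝓝 ((Λ₀ : E4 ≃L[ℝ] E4).symm : E4 →L[ℝ] E4)) →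
      Tendsto cs atTop (𝓝 c₀) → Tendsto p atTop (𝓝 p₀) →
      Tendsto (fun n ↦ supCkENorm K k
        (fun x ↦ G n x - boostedKerrBilin (Λs n) (cs n) (p n).1 (p n).2 x)) atTop (𝓝 0) →
      Tendsto (fun n ↦ supCkENorm K k (fun x ↦ G n x - boostedKerrBilin Λ₀ c₀ p₀.1 p₀.2 x))
        atTop (𝓝 0) := by
  intro K hK Λ₀ c₀ p₀ hp₀ k O hO hKO G hG Λs cs p hL hc hp hT
  have hπ : Tendsto (fun n ↦ ((p n, (((Λs n : E4 ≃L[ℝ] E4).symm : E4 →L[ℝ] E4), cs n)) :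
      (ℝ × ℝ) × ((E4 →L[ℝ] E4) × E4))) atTop
      (𝓝 (p₀, (((Λ₀ : E4 ≃L[ℝ] E4).symm : E4 →L[ℝ] E4), c₀))) :=
    hp.prodMk_nhds (hL.prodMk_nhds hc)
  -- read every `boostedKerrBilin Λ c M a` as the member `((M, a), (Λ⁻¹, c))` of the family
  simp only [boostedKerrBilin_eq_precomp_kerrBilin] at hT ⊢
  have h := tendsto_supCkENorm_sub_precomp_kerrBilin_of_tendsto
    (π₀ := (p₀, (((Λ₀ : E4 ≃L[ℝ] E4).symm : E4 →L[ℝ] E4), c₀)))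
    (π := fun n ↦ (p n, (((Λs n : E4 ≃L[ℝ] E4).symm : E4 →L[ℝ] E4), cs n))) hK hp₀ hO hKO hG
    hπ hT
  exact h

/-- **Select-and-rebase, MOTION half: `Cᵏ` closeness on a compact set to boosted Kerr with
converging motions (inverse boosts converging in operator norm, centres converging) is `Cᵏ`
closeness to the limit motion** — the fixed-label form of
`tendsto_supCkENorm_sub_boostedKerrBilin_of_tendsto_labels_motions` (constant labels `(M, a)`).
[folklore] -/
theorem tendsto_supCkENorm_sub_boostedKerrBilin_of_tendsto_motions (M a : ℝ) {K : Set E4}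
    (hK : IsCompact K) {Λ₀ : lorentzGroup} {c₀ : E4}
    (h₀ : ∀ x ∈ K, 0 < Kerr.radius a (poincareInv Λ₀ c₀ x)) {k : ℕ} {O : Set E4}
    (hO : IsOpen O) (hKO : K ⊆ O) {G : ℕ → E4 → E4 →L[ℝ] E4 →L[ℝ] ℝ}
    (hG : ∀ n, ContDiffOn ℝ k (G n) O) {Λs : ℕ → lorentzGroup} {cs : ℕ → E4}
    (hL : Tendsto (fun n ↦ ((Λs n : E4 ≃L[ℝ] E4).symm : E4 →L[ℝ] E4)) atTop
      (𝓝 ((Λ₀ : E4 ≃L[ℝ] E4).symm : E4 →L[ℝ] E4)))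
    (hc : Tendsto cs atTop (𝓝 c₀))
    (hT : Tendsto (fun n ↦ supCkENorm K k
      (fun x ↦ G n x - boostedKerrBilin (Λs n) (cs n) M a x)) atTop (𝓝 0)) :
    Tendsto (fun n ↦ supCkENorm K k (fun x ↦ G n x - boostedKerrBilin Λ₀ c₀ M a x))
      atTop (𝓝 0) :=
  tendsto_supCkENorm_sub_boostedKerrBilin_of_tendsto_labels_motions hK (p₀ := (M, a)) h₀ hO hKO
    hG (p := fun _ ↦ (M, a)) hL hc tendsto_const_nhds hT

/-- **The `∃ᶠ`-form** (the shape of the crux's recurrence clause): under the hypotheses of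
`tendsto_supCkENorm_sub_boostedKerrBilin_of_tendsto_labels_motions`, if for every `ε > 0`
frequently `‖Gₙ − boostedKerrBilin Λₙ cₙ Mₙ aₙ‖_{Cᵏ(K)} ≤ ε`, then for every `ε > 0` frequently
`‖Gₙ − boostedKerrBilin Λ₀ c₀ M₀ a₀‖_{Cᵏ(K)} ≤ ε` (extract a subsequence along which the former
tends to `0`, `Filter.extraction_forall_of_frequently`, and rebase it). [folklore] -/
theorem frequently_supCkENorm_sub_boostedKerrBilin_le_of_tendsto_labels_motions {K : Set E4}
    (hK : IsCompact K) {Λ₀ : lorentzGroup} {c₀ : E4} {p₀ : ℝ × ℝ}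
    (hp₀ : ∀ x ∈ K, 0 < Kerr.radius p₀.2 (poincareInv Λ₀ c₀ x)) {k : ℕ} {O : Set E4}
    (hO : IsOpen O) (hKO : K ⊆ O) {G : ℕ → E4 → E4 →L[ℝ] E4 →L[ℝ] ℝ}
    (hG : ∀ n, ContDiffOn ℝ k (G n) O) {Λs : ℕ → lorentzGroup} {cs : ℕ → E4} {p : ℕ → ℝ × ℝ}
    (hL : Tendsto (fun n ↦ ((Λs n : E4 ≃L[ℝ] E4).symm : E4 →L[ℝ] E4)) atTop
      (𝓝 ((Λ₀ : E4 ≃L[ℝ] E4).symm : E4 →L[ℝ] E4)))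
    (hc : Tendsto cs atTop (𝓝 c₀)) (hp : Tendsto p atTop (𝓝 p₀))
    (hfr : ∀ ε : ℝ, 0 < ε → ∃ᶠ n in atTop, supCkENorm K k
      (fun x ↦ G n x - boostedKerrBilin (Λs n) (cs n) (p n).1 (p n).2 x) ≤ ENNReal.ofReal ε)
    {ε : ℝ} (hε : 0 < ε) :
    ∃ᶠ n in atTop,
      supCkENorm K k (fun x ↦ G n x - boostedKerrBilin Λ₀ c₀ p₀.1 p₀.2 x) ≤ ENNReal.ofReal ε := by
  -- a subsequence along which the deviation from the wandering configurations tends to `0`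
  obtain ⟨φ, hφ, hφle⟩ := extraction_forall_of_frequently fun m : ℕ ↦
    hfr (1 / ((m : ℝ) + 1)) Nat.one_div_pos_of_nat
  have hT : Tendsto (fun m ↦ supCkENorm K k (fun x ↦ G (φ m) x -
      boostedKerrBilin (Λs (φ m)) (cs (φ m)) (p (φ m)).1 (p (φ m)).2 x)) atTop (𝓝 0) := by
    have h0 : Tendsto (fun m : ℕ ↦ ENNReal.ofReal (1 / ((m : ℝ) + 1))) atTop (𝓝 0) := by
      simpa only [ENNReal.ofReal_zero] using
        ENNReal.tendsto_ofReal tendsto_one_div_add_atTop_nhds_zero_nat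
    exact tendsto_of_tendsto_of_tendsto_of_le_of_le' tendsto_const_nhds h0
      (Eventually.of_forall fun _ ↦ zero_le) (Eventually.of_forall hφle)
  have hlim := tendsto_supCkENorm_sub_boostedKerrBilin_of_tendsto_labels_motions hK hp₀ hO hKO
    (G := fun m ↦ G (φ m)) (fun m ↦ hG (φ m)) (Λs := fun m ↦ Λs (φ m))
    (hL.comp hφ.tendsto_atTop) (hc.comp hφ.tendsto_atTop) (hp.comp hφ.tendsto_atTop) hT
  have hev : ∀ᶠ m in atTop, supCkENorm K k
      (fun x ↦ G (φ m) x - boostedKerrBilin Λ₀ c₀ p₀.1 p₀.2 x) ≤ ENNReal.ofReal ε :=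
    hlim (ge_mem_nhds (ENNReal.ofReal_pos.2 hε))
  exact hφ.tendsto_atTop.frequently hev.frequently

end Summit.FinalStateConjecture.FinalStateConjecture.Theorems.ClusterCompleteness

end
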